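import Summits.BirchSwinnertonDyer.BirchSwinnertonDyer.Theorems.ClassRecordThreeReg3CertModelsDefs
import Summits.BirchSwinnertonDyer.BirchSwinnertonDyer.Theorems.ClassRecordThreeRung62310y1Witness
import Summits.BirchSwinnertonDyer.BirchSwinnertonDyer.Theorems.ClassRecordThreeRegCertRows01
import Summits.BirchSwinnertonDyer.BirchSwinnertonDyer.Theorems.ClassRecordThreeRegCertRows02
import Summits.BirchSwinnertonDyer.BirchSwinnertonDyer.Theorems.ClassRecordThreeRegCertRows03
import Summits.BirchSwinnertonDyer.BirchSwinnertonDyer.Theorems.ClassRecordThreeRegCertRows04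
import Summits.BirchSwinnertonDyer.BirchSwinnertonDyer.Theorems.ClassRecordThreeRegCertRows05
import Summits.BirchSwinnertonDyer.BirchSwinnertonDyer.Theorems.ClassRecordThreeRegCertRows06
import Summits.BirchSwinnertonDyer.BirchSwinnertonDyer.Theorems.ClassRecordThreeRegCertRows07
import Summits.BirchSwinnertonDyer.BirchSwinnertonDyer.Theorems.ClassRecordThreeRegCertRows08
import Summits.BirchSwinnertonDyer.BirchSwinnertonDyer.Theorems.ClassRecordThreeRegCertRows09
import Summits.BirchSwinnertonDyer.BirchSwinnertonDyer.Theorems.ClassRecordThreeRegCertRows10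
import Summits.BirchSwinnertonDyer.BirchSwinnertonDyer.Theorems.ClassRecordThreeRegCertRows11
import HarnessLib

/-!
# Route `ClassRecordThree`, crux `SchneiderAtThree` (item 19106): the REG3CERT finite-table consumer, chunk 1 ∕ 4
# (cell `bsd-stepL`, seat `bsd-stepL-reg3-eng` g5; `--supports stmt-BirchSwinnertonDyer-19106`)

HONEST FRAMING: BSD is not proved by any of this; nothing here closes the crux; Schneider's non-degeneracy conjecture
(barrier `PAdicHeightNondegeneracy`) is asserted NOWHERE; the theorem below is a FINITE conjunction of per-curve rung
theorems, one for each of the 181 models of `Reg3Cert.reg3certModels₁` (Cremona `62310y1` … `192444k1`), each of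
which was already a kernel theorem modulo GZK (`Rows.rung_<label>` in `Theorems/ClassRecordThreeRegCertRows*.lean`, the BC5 rung `Rung62310y1.rung_62310y1_of_GZK`). The proof walks the
list literal: `W ∈ a :: l ↔ W = a ∨ W ∈ l`, one row theorem per head. Theorems only (0 defs, 0 facts).
References: [SteinWuthrich2013] §4.2 and Conj. 4.1; [KolyvaginEulerSystems1990] Thm. A (GZK).
-/

open WeierstrassCurve Literature.NumberTheory.EllipticCurves
  Literature.NumberTheory.EllipticCurves.Rank1Residual
  Summit.BirchSwinnertonDyer.Rank1Residual
  Summit.BirchSwinnertonDyer.Rank1Residual.X11b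
  Summit.BirchSwinnertonDyer.Rank1Residual.X11b.RegMult

namespace Summit.BirchSwinnertonDyer.Rank1Residual.X11b.RegMult.Reg3Cert

/-- **REG3CERT rungs, chunk 1 ∕ 4.** For every globally minimal `W` among the 181 models of
`reg3certModels₁` (Cremona `62310y1` … `192444k1`): from the PUBLISHED fact GZK
(`rank_eq_analyticRank_of_analyticRank_le_one`), `ClassX11b W 3 → Ram W 3 → ¬ split(3) →
ClassClosure.RegulatorNonvanishingAt W 3` — the matrix of crux `SchneiderAtThree` at that curve, by the row's kernel
certificate. A finite conjunction of ONE-curve theorems; nothing class-wide; closes nothing by itself.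
[cite: SteinWuthrich2013, §4.2 and Conj. 4.1] [cite: KolyvaginEulerSystems1990, Thm. A] -/
theorem rung_of_mem_reg3certModels₁ (hGZK : rank_eq_analyticRank_of_analyticRank_le_one) (W : WeierstrassCurve ℚ)
    [W.IsElliptic] [W.IsGloballyMinimal] (hW : W ∈ reg3certModels₁) :
    ClassX11b W 3 → Ram W 3 → ¬ W.HasSplitMultiplicativeReductionAtPrime 3 →
      ClassClosure.RegulatorNonvanishingAt W 3 := by
  unfold reg3certModels₁ at hW
  refine (List.mem_cons.mp hW).elim (fun h => Rung62310y1.rung_62310y1_of_GZK hGZK W h) fun hW => ?_  -- 62310y1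
  refine (List.mem_cons.mp hW).elim (fun h => Rows.rung_94458u1 hGZK W h) fun hW => ?_  -- 94458u1
  refine (List.mem_cons.mp hW).elim (fun h => Rows.rung_157530m1 hGZK W h) fun hW => ?_  -- 157530m1
  refine (List.mem_cons.mp hW).elim (fun h => Rows.rung_197580e1 hGZK W h) fun hW => ?_  -- 197580e1
  refine (List.mem_cons.mp hW).elim (fun h => Rows.rung_248556a1 hGZK W h) fun hW => ?_  -- 248556a1
  refine (List.mem_cons.mp hW).elim (fun h => Rows.rung_254562g1 hGZK W h) fun hW => ?_  -- 254562g1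
  refine (List.mem_cons.mp hW).elim (fun h => Rows.rung_291270j1 hGZK W h) fun hW => ?_  -- 291270j1
  refine (List.mem_cons.mp hW).elim (fun h => Rows.rung_297330w1 hGZK W h) fun hW => ?_  -- 297330w1
  refine (List.mem_cons.mp hW).elim (fun h => Rows.rung_331482c1 hGZK W h) fun hW => ?_  -- 331482c1
  refine (List.mem_cons.mp hW).elim (fun h => Rows.rung_350490b1 hGZK W h) fun hW => ?_  -- 350490b1
  refine (List.mem_cons.mp hW).elim (fun h => Rows.rung_382296b1 hGZK W h) fun hW => ?_  -- 382296b1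
  refine (List.mem_cons.mp hW).elim (fun h => Rows.rung_385662a1 hGZK W h) fun hW => ?_  -- 385662a1
  refine (List.mem_cons.mp hW).elim (fun h => Rows.rung_392196f1 hGZK W h) fun hW => ?_  -- 392196f1
  refine (List.mem_cons.mp hW).elim (fun h => Rows.rung_423024x1 hGZK W h) fun hW => ?_  -- 423024x1
  refine (List.mem_cons.mp hW).elim (fun h => Rows.rung_458796a1 hGZK W h) fun hW => ?_  -- 458796a1
  refine (List.mem_cons.mp hW).elim (fun h => Rows.rung_490200n1 hGZK W h) fun hW => ?_  -- 490200n1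
  refine (List.mem_cons.mp hW).elim (fun h => Rows.rung_493986a1 hGZK W h) fun hW => ?_  -- 493986a1
  refine (List.mem_cons.mp hW).elim (fun h => Rows.rung_108186i1 hGZK W h) fun hW => ?_  -- 108186i1
  refine (List.mem_cons.mp hW).elim (fun h => Rows.rung_115710j1 hGZK W h) fun hW => ?_  -- 115710j1
  refine (List.mem_cons.mp hW).elim (fun h => Rows.rung_219198bb1 hGZK W h) fun hW => ?_  -- 219198bb1
  refine (List.mem_cons.mp hW).elim (fun h => Rows.rung_227640t1 hGZK W h) fun hW => ?_  -- 227640t1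
  refine (List.mem_cons.mp hW).elim (fun h => Rows.rung_259896r1 hGZK W h) fun hW => ?_  -- 259896r1
  refine (List.mem_cons.mp hW).elim (fun h => Rows.rung_313170i1 hGZK W h) fun hW => ?_  -- 313170i1
  refine (List.mem_cons.mp hW).elim (fun h => Rows.rung_341850bc1 hGZK W h) fun hW => ?_  -- 341850bc1
  refine (List.mem_cons.mp hW).elim (fun h => Rows.rung_369642a1 hGZK W h) fun hW => ?_  -- 369642a1
  refine (List.mem_cons.mp hW).elim (fun h => Rows.rung_371280db1 hGZK W h) fun hW => ?_  -- 371280db1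
  refine (List.mem_cons.mp hW).elim (fun h => Rows.rung_376530a1 hGZK W h) fun hW => ?_  -- 376530a1
  refine (List.mem_cons.mp hW).elim (fun h => Rows.rung_432600bd1 hGZK W h) fun hW => ?_  -- 432600bd1
  refine (List.mem_cons.mp hW).elim (fun h => Rows.rung_453054p1 hGZK W h) fun hW => ?_  -- 453054p1
  refine (List.mem_cons.mp hW).elim (fun h => Rows.rung_486330g1 hGZK W h) fun hW => ?_  -- 486330g1
  refine (List.mem_cons.mp hW).elim (fun h => Rows.rung_98790q1 hGZK W h) fun hW => ?_  -- 98790q1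
  refine (List.mem_cons.mp hW).elim (fun h => Rows.rung_101010b1 hGZK W h) fun hW => ?_  -- 101010b1
  refine (List.mem_cons.mp hW).elim (fun h => Rows.rung_142674k1 hGZK W h) fun hW => ?_  -- 142674k1
  refine (List.mem_cons.mp hW).elim (fun h => Rows.rung_201630u1 hGZK W h) fun hW => ?_  -- 201630u1
  refine (List.mem_cons.mp hW).elim (fun h => Rows.rung_212565e1 hGZK W h) fun hW => ?_  -- 212565e1
  refine (List.mem_cons.mp hW).elim (fun h => Rows.rung_235410f1 hGZK W h) fun hW => ?_  -- 235410f1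
  refine (List.mem_cons.mp hW).elim (fun h => Rows.rung_362370a1 hGZK W h) fun hW => ?_  -- 362370a1
  refine (List.mem_cons.mp hW).elim (fun h => Rows.rung_362550b1 hGZK W h) fun hW => ?_  -- 362550b1
  refine (List.mem_cons.mp hW).elim (fun h => Rows.rung_425040bc1 hGZK W h) fun hW => ?_  -- 425040bc1
  refine (List.mem_cons.mp hW).elim (fun h => Rows.rung_438360g1 hGZK W h) fun hW => ?_  -- 438360g1
  refine (List.mem_cons.mp hW).elim (fun h => Rows.rung_482160db1 hGZK W h) fun hW => ?_  -- 482160db1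
  refine (List.mem_cons.mp hW).elim (fun h => Rows.rung_216690l1 hGZK W h) fun hW => ?_  -- 216690l1
  refine (List.mem_cons.mp hW).elim (fun h => Rows.rung_243390bg1 hGZK W h) fun hW => ?_  -- 243390bg1
  refine (List.mem_cons.mp hW).elim (fun h => Rows.rung_263760d1 hGZK W h) fun hW => ?_  -- 263760d1
  refine (List.mem_cons.mp hW).elim (fun h => Rows.rung_274170i1 hGZK W h) fun hW => ?_  -- 274170i1
  refine (List.mem_cons.mp hW).elim (fun h => Rows.rung_297024ca1 hGZK W h) fun hW => ?_  -- 297024ca1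
  refine (List.mem_cons.mp hW).elim (fun h => Rows.rung_353760e1 hGZK W h) fun hW => ?_  -- 353760e1
  refine (List.mem_cons.mp hW).elim (fun h => Rows.rung_353760f1 hGZK W h) fun hW => ?_  -- 353760f1
  refine (List.mem_cons.mp hW).elim (fun h => Rows.rung_367665e1 hGZK W h) fun hW => ?_  -- 367665e1
  refine (List.mem_cons.mp hW).elim (fun h => Rows.rung_410865o1 hGZK W h) fun hW => ?_  -- 410865o1
  refine (List.mem_cons.mp hW).elim (fun h => Rows.rung_417480j1 hGZK W h) fun hW => ?_  -- 417480j1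
  refine (List.mem_cons.mp hW).elim (fun h => Rows.rung_419430j1 hGZK W h) fun hW => ?_  -- 419430j1
  refine (List.mem_cons.mp hW).elim (fun h => Rows.rung_436737g1 hGZK W h) fun hW => ?_  -- 436737g1
  refine (List.mem_cons.mp hW).elim (fun h => Rows.rung_450240l1 hGZK W h) fun hW => ?_  -- 450240l1
  refine (List.mem_cons.mp hW).elim (fun h => Rows.rung_454974b1 hGZK W h) fun hW => ?_  -- 454974b1
  refine (List.mem_cons.mp hW).elim (fun h => Rows.rung_238434a1 hGZK W h) fun hW => ?_  -- 238434a1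
  refine (List.mem_cons.mp hW).elim (fun h => Rows.rung_258060d1 hGZK W h) fun hW => ?_  -- 258060d1
  refine (List.mem_cons.mp hW).elim (fun h => Rows.rung_294690h1 hGZK W h) fun hW => ?_  -- 294690h1
  refine (List.mem_cons.mp hW).elim (fun h => Rows.rung_338430e1 hGZK W h) fun hW => ?_  -- 338430e1
  refine (List.mem_cons.mp hW).elim (fun h => Rows.rung_348234f1 hGZK W h) fun hW => ?_  -- 348234f1
  refine (List.mem_cons.mp hW).elim (fun h => Rows.rung_362850b1 hGZK W h) fun hW => ?_  -- 362850b1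
  refine (List.mem_cons.mp hW).elim (fun h => Rows.rung_385710g1 hGZK W h) fun hW => ?_  -- 385710g1
  refine (List.mem_cons.mp hW).elim (fun h => Rows.rung_418440f1 hGZK W h) fun hW => ?_  -- 418440f1
  refine (List.mem_cons.mp hW).elim (fun h => Rows.rung_451437b1 hGZK W h) fun hW => ?_  -- 451437b1
  refine (List.mem_cons.mp hW).elim (fun h => Rows.rung_460023a1 hGZK W h) fun hW => ?_  -- 460023a1
  refine (List.mem_cons.mp hW).elim (fun h => Rows.rung_480048e1 hGZK W h) fun hW => ?_  -- 480048e1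
  refine (List.mem_cons.mp hW).elim (fun h => Rows.rung_125580f1 hGZK W h) fun hW => ?_  -- 125580f1
  refine (List.mem_cons.mp hW).elim (fun h => Rows.rung_200928s1 hGZK W h) fun hW => ?_  -- 200928s1
  refine (List.mem_cons.mp hW).elim (fun h => Rows.rung_259653e1 hGZK W h) fun hW => ?_  -- 259653e1
  refine (List.mem_cons.mp hW).elim (fun h => Rows.rung_269310k1 hGZK W h) fun hW => ?_  -- 269310k1
  refine (List.mem_cons.mp hW).elim (fun h => Rows.rung_276528a1 hGZK W h) fun hW => ?_  -- 276528a1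
  refine (List.mem_cons.mp hW).elim (fun h => Rows.rung_301980a1 hGZK W h) fun hW => ?_  -- 301980a1
  refine (List.mem_cons.mp hW).elim (fun h => Rows.rung_334950v1 hGZK W h) fun hW => ?_  -- 334950v1
  refine (List.mem_cons.mp hW).elim (fun h => Rows.rung_337260a1 hGZK W h) fun hW => ?_  -- 337260a1
  refine (List.mem_cons.mp hW).elim (fun h => Rows.rung_373800bg1 hGZK W h) fun hW => ?_  -- 373800bg1
  refine (List.mem_cons.mp hW).elim (fun h => Rows.rung_379248f1 hGZK W h) fun hW => ?_  -- 379248f1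
  refine (List.mem_cons.mp hW).elim (fun h => Rows.rung_468519c1 hGZK W h) fun hW => ?_  -- 468519c1
  refine (List.mem_cons.mp hW).elim (fun h => Rows.rung_483510i1 hGZK W h) fun hW => ?_  -- 483510i1
  refine (List.mem_cons.mp hW).elim (fun h => Rows.rung_487050cf1 hGZK W h) fun hW => ?_  -- 487050cf1
  refine (List.mem_cons.mp hW).elim (fun h => Rows.rung_193830bu1 hGZK W h) fun hW => ?_  -- 193830bu1
  refine (List.mem_cons.mp hW).elim (fun h => Rows.rung_287430l1 hGZK W h) fun hW => ?_  -- 287430l1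
  refine (List.mem_cons.mp hW).elim (fun h => Rows.rung_338520a1 hGZK W h) fun hW => ?_  -- 338520a1
  refine (List.mem_cons.mp hW).elim (fun h => Rows.rung_351120cz1 hGZK W h) fun hW => ?_  -- 351120cz1
  refine (List.mem_cons.mp hW).elim (fun h => Rows.rung_410520b1 hGZK W h) fun hW => ?_  -- 410520b1
  refine (List.mem_cons.mp hW).elim (fun h => Rows.rung_464646p1 hGZK W h) fun hW => ?_  -- 464646p1
  refine (List.mem_cons.mp hW).elim (fun h => Rows.rung_466350e1 hGZK W h) fun hW => ?_  -- 466350e1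
  refine (List.mem_cons.mp hW).elim (fun h => Rows.rung_474546a1 hGZK W h) fun hW => ?_  -- 474546a1
  refine (List.mem_cons.mp hW).elim (fun h => Rows.rung_482160ca1 hGZK W h) fun hW => ?_  -- 482160ca1
  refine (List.mem_cons.mp hW).elim (fun h => Rows.rung_318630a1 hGZK W h) fun hW => ?_  -- 318630a1
  refine (List.mem_cons.mp hW).elim (fun h => Rows.rung_327360ex1 hGZK W h) fun hW => ?_  -- 327360ex1
  refine (List.mem_cons.mp hW).elim (fun h => Rows.rung_409200j1 hGZK W h) fun hW => ?_  -- 409200j1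
  refine (List.mem_cons.mp hW).elim (fun h => Rows.rung_417840e1 hGZK W h) fun hW => ?_  -- 417840e1
  refine (List.mem_cons.mp hW).elim (fun h => Rows.rung_420546bd1 hGZK W h) fun hW => ?_  -- 420546bd1
  refine (List.mem_cons.mp hW).elim (fun h => Rows.rung_220080cw1 hGZK W h) fun hW => ?_  -- 220080cw1
  refine (List.mem_cons.mp hW).elim (fun h => Rows.rung_247170u1 hGZK W h) fun hW => ?_  -- 247170u1
  refine (List.mem_cons.mp hW).elim (fun h => Rows.rung_326370c1 hGZK W h) fun hW => ?_  -- 326370c1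
  refine (List.mem_cons.mp hW).elim (fun h => Rows.rung_355110e1 hGZK W h) fun hW => ?_  -- 355110e1
  refine (List.mem_cons.mp hW).elim (fun h => Rows.rung_441210bf1 hGZK W h) fun hW => ?_  -- 441210bf1
  refine (List.mem_cons.mp hW).elim (fun h => Rows.rung_475800bf1 hGZK W h) fun hW => ?_  -- 475800bf1
  refine (List.mem_cons.mp hW).elim (fun h => Rows.rung_113703a1 hGZK W h) fun hW => ?_  -- 113703a1
  refine (List.mem_cons.mp hW).elim (fun h => Rows.rung_182910bx1 hGZK W h) fun hW => ?_  -- 182910bx1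
  refine (List.mem_cons.mp hW).elim (fun h => Rows.rung_344694z1 hGZK W h) fun hW => ?_  -- 344694z1
  refine (List.mem_cons.mp hW).elim (fun h => Rows.rung_351120dl1 hGZK W h) fun hW => ?_  -- 351120dl1
  refine (List.mem_cons.mp hW).elim (fun h => Rows.rung_389436b1 hGZK W h) fun hW => ?_  -- 389436b1
  refine (List.mem_cons.mp hW).elim (fun h => Rows.rung_416640a1 hGZK W h) fun hW => ?_  -- 416640a1
  refine (List.mem_cons.mp hW).elim (fun h => Rows.rung_483510f1 hGZK W h) fun hW => ?_  -- 483510f1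
  refine (List.mem_cons.mp hW).elim (fun h => Rows.rung_494160m1 hGZK W h) fun hW => ?_  -- 494160m1
  refine (List.mem_cons.mp hW).elim (fun h => Rows.rung_241230v1 hGZK W h) fun hW => ?_  -- 241230v1
  refine (List.mem_cons.mp hW).elim (fun h => Rows.rung_243984bd1 hGZK W h) fun hW => ?_  -- 243984bd1
  refine (List.mem_cons.mp hW).elim (fun h => Rows.rung_400980a1 hGZK W h) fun hW => ?_  -- 400980a1
  refine (List.mem_cons.mp hW).elim (fun h => Rows.rung_409200cw1 hGZK W h) fun hW => ?_  -- 409200cw1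
  refine (List.mem_cons.mp hW).elim (fun h => Rows.rung_496410g1 hGZK W h) fun hW => ?_  -- 496410g1
  refine (List.mem_cons.mp hW).elim (fun h => Rows.rung_99330a1 hGZK W h) fun hW => ?_  -- 99330a1
  refine (List.mem_cons.mp hW).elim (fun h => Rows.rung_377400u1 hGZK W h) fun hW => ?_  -- 377400u1
  refine (List.mem_cons.mp hW).elim (fun h => Rows.rung_380190bh1 hGZK W h) fun hW => ?_  -- 380190bh1
  refine (List.mem_cons.mp hW).elim (fun h => Rows.rung_395430bf1 hGZK W h) fun hW => ?_  -- 395430bf1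
  refine (List.mem_cons.mp hW).elim (fun h => Rows.rung_280698d1 hGZK W h) fun hW => ?_  -- 280698d1
  refine (List.mem_cons.mp hW).elim (fun h => Rows.rung_452166s1 hGZK W h) fun hW => ?_  -- 452166s1
  refine (List.mem_cons.mp hW).elim (fun h => Rows.rung_479550a1 hGZK W h) fun hW => ?_  -- 479550a1
  refine (List.mem_cons.mp hW).elim (fun h => Rows.rung_196050ba1 hGZK W h) fun hW => ?_  -- 196050ba1
  refine (List.mem_cons.mp hW).elim (fun h => Rows.rung_216258z1 hGZK W h) fun hW => ?_  -- 216258z1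
  refine (List.mem_cons.mp hW).elim (fun h => Rows.rung_320235g1 hGZK W h) fun hW => ?_  -- 320235g1
  refine (List.mem_cons.mp hW).elim (fun h => Rows.rung_331779a1 hGZK W h) fun hW => ?_  -- 331779a1
  refine (List.mem_cons.mp hW).elim (fun h => Rows.rung_347253a1 hGZK W h) fun hW => ?_  -- 347253a1
  refine (List.mem_cons.mp hW).elim (fun h => Rows.rung_350520b1 hGZK W h) fun hW => ?_  -- 350520b1
  refine (List.mem_cons.mp hW).elim (fun h => Rows.rung_351120bu1 hGZK W h) fun hW => ?_  -- 351120bu1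
  refine (List.mem_cons.mp hW).elim (fun h => Rows.rung_443400c1 hGZK W h) fun hW => ?_  -- 443400c1
  refine (List.mem_cons.mp hW).elim (fun h => Rows.rung_477120l1 hGZK W h) fun hW => ?_  -- 477120l1
  refine (List.mem_cons.mp hW).elim (fun h => Rows.rung_207570ca1 hGZK W h) fun hW => ?_  -- 207570ca1
  refine (List.mem_cons.mp hW).elim (fun h => Rows.rung_235410a1 hGZK W h) fun hW => ?_  -- 235410a1
  refine (List.mem_cons.mp hW).elim (fun h => Rows.rung_253266c1 hGZK W h) fun hW => ?_  -- 253266c1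
  refine (List.mem_cons.mp hW).elim (fun h => Rows.rung_271320i1 hGZK W h) fun hW => ?_  -- 271320i1
  refine (List.mem_cons.mp hW).elim (fun h => Rows.rung_342006bf1 hGZK W h) fun hW => ?_  -- 342006bf1
  refine (List.mem_cons.mp hW).elim (fun h => Rows.rung_362100j1 hGZK W h) fun hW => ?_  -- 362100j1
  refine (List.mem_cons.mp hW).elim (fun h => Rows.rung_367710bn1 hGZK W h) fun hW => ?_  -- 367710bn1
  refine (List.mem_cons.mp hW).elim (fun h => Rows.rung_382458b1 hGZK W h) fun hW => ?_  -- 382458b1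
  refine (List.mem_cons.mp hW).elim (fun h => Rows.rung_438090b1 hGZK W h) fun hW => ?_  -- 438090b1
  refine (List.mem_cons.mp hW).elim (fun h => Rows.rung_457968y1 hGZK W h) fun hW => ?_  -- 457968y1
  refine (List.mem_cons.mp hW).elim (fun h => Rows.rung_463926a1 hGZK W h) fun hW => ?_  -- 463926a1
  refine (List.mem_cons.mp hW).elim (fun h => Rows.rung_489342c1 hGZK W h) fun hW => ?_  -- 489342c1
  refine (List.mem_cons.mp hW).elim (fun h => Rows.rung_230010a1 hGZK W h) fun hW => ?_  -- 230010a1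
  refine (List.mem_cons.mp hW).elim (fun h => Rows.rung_338910e1 hGZK W h) fun hW => ?_  -- 338910e1
  refine (List.mem_cons.mp hW).elim (fun h => Rows.rung_410190bk1 hGZK W h) fun hW => ?_  -- 410190bk1
  refine (List.mem_cons.mp hW).elim (fun h => Rows.rung_454974e1 hGZK W h) fun hW => ?_  -- 454974e1
  refine (List.mem_cons.mp hW).elim (fun h => Rows.rung_491610b1 hGZK W h) fun hW => ?_  -- 491610b1
  refine (List.mem_cons.mp hW).elim (fun h => Rows.rung_361284d1 hGZK W h) fun hW => ?_  -- 361284d1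
  refine (List.mem_cons.mp hW).elim (fun h => Rows.rung_408408v1 hGZK W h) fun hW => ?_  -- 408408v1
  refine (List.mem_cons.mp hW).elim (fun h => Rows.rung_438450bm1 hGZK W h) fun hW => ?_  -- 438450bm1
  refine (List.mem_cons.mp hW).elim (fun h => Rows.rung_494070d1 hGZK W h) fun hW => ?_  -- 494070d1
  refine (List.mem_cons.mp hW).elim (fun h => Rows.rung_204360h1 hGZK W h) fun hW => ?_  -- 204360h1
  refine (List.mem_cons.mp hW).elim (fun h => Rows.rung_388740a1 hGZK W h) fun hW => ?_  -- 388740a1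
  refine (List.mem_cons.mp hW).elim (fun h => Rows.rung_477120v1 hGZK W h) fun hW => ?_  -- 477120v1
  refine (List.mem_cons.mp hW).elim (fun h => Rows.rung_219450gu1 hGZK W h) fun hW => ?_  -- 219450gu1
  refine (List.mem_cons.mp hW).elim (fun h => Rows.rung_456456v1 hGZK W h) fun hW => ?_  -- 456456v1
  refine (List.mem_cons.mp hW).elim (fun h => Rows.rung_468438b1 hGZK W h) fun hW => ?_  -- 468438b1
  refine (List.mem_cons.mp hW).elim (fun h => Rows.rung_269610i1 hGZK W h) fun hW => ?_  -- 269610i1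
  refine (List.mem_cons.mp hW).elim (fun h => Rows.rung_335202d1 hGZK W h) fun hW => ?_  -- 335202d1
  refine (List.mem_cons.mp hW).elim (fun h => Rows.rung_459192f1 hGZK W h) fun hW => ?_  -- 459192f1
  refine (List.mem_cons.mp hW).elim (fun h => Rows.rung_82110bn1 hGZK W h) fun hW => ?_  -- 82110bn1
  refine (List.mem_cons.mp hW).elim (fun h => Rows.rung_175440bi1 hGZK W h) fun hW => ?_  -- 175440bi1
  refine (List.mem_cons.mp hW).elim (fun h => Rows.rung_317730g1 hGZK W h) fun hW => ?_  -- 317730g1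
  refine (List.mem_cons.mp hW).elim (fun h => Rows.rung_419748d1 hGZK W h) fun hW => ?_  -- 419748d1
  refine (List.mem_cons.mp hW).elim (fun h => Rows.rung_440040c1 hGZK W h) fun hW => ?_  -- 440040c1
  refine (List.mem_cons.mp hW).elim (fun h => Rows.rung_467646c1 hGZK W h) fun hW => ?_  -- 467646c1
  refine (List.mem_cons.mp hW).elim (fun h => Rows.rung_227370cj1 hGZK W h) fun hW => ?_  -- 227370cj1
  refine (List.mem_cons.mp hW).elim (fun h => Rows.rung_298650l1 hGZK W h) fun hW => ?_  -- 298650l1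
  refine (List.mem_cons.mp hW).elim (fun h => Rows.rung_397290c1 hGZK W h) fun hW => ?_  -- 397290c1
  refine (List.mem_cons.mp hW).elim (fun h => Rows.rung_457746a1 hGZK W h) fun hW => ?_  -- 457746a1
  refine (List.mem_cons.mp hW).elim (fun h => Rows.rung_463638bs1 hGZK W h) fun hW => ?_  -- 463638bs1
  refine (List.mem_cons.mp hW).elim (fun h => Rows.rung_162690cr1 hGZK W h) fun hW => ?_  -- 162690cr1
  refine (List.mem_cons.mp hW).elim (fun h => Rows.rung_333870b1 hGZK W h) fun hW => ?_  -- 333870b1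
  refine (List.mem_cons.mp hW).elim (fun h => Rows.rung_355110bc1 hGZK W h) fun hW => ?_  -- 355110bc1
  refine (List.mem_cons.mp hW).elim (fun h => Rows.rung_170040m1 hGZK W h) fun hW => ?_  -- 170040m1
  refine (List.mem_cons.mp hW).elim (fun h => Rows.rung_291720bd1 hGZK W h) fun hW => ?_  -- 291720bd1
  refine (List.mem_cons.mp hW).elim (fun h => Rows.rung_355470j1 hGZK W h) fun hW => ?_  -- 355470j1
  refine (List.mem_cons.mp hW).elim (fun h => Rows.rung_298320g1 hGZK W h) fun hW => ?_  -- 298320g1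
  refine (List.mem_cons.mp hW).elim (fun h => Rows.rung_341850ba1 hGZK W h) fun hW => ?_  -- 341850ba1
  refine (List.mem_cons.mp hW).elim (fun h => Rows.rung_265350q1 hGZK W h) fun hW => ?_  -- 265350q1
  refine (List.mem_cons.mp hW).elim (fun h => Rows.rung_497640e1 hGZK W h) fun hW => ?_  -- 497640e1
  refine (List.mem_cons.mp hW).elim (fun h => Rows.rung_179088bg1 hGZK W h) fun hW => ?_  -- 179088bg1
  refine (List.mem_cons.mp hW).elim (fun h => Rows.rung_192444k1 hGZK W h) fun hW => ?_  -- 192444k1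
  exact nomatch hW

end Summit.BirchSwinnertonDyer.Rank1Residual.X11b.RegMult.Reg3Cert
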